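import Literature.Analysis.ODE.PathDrivenSmoothDependence
import Literature.Analysis.ODE.IntegralGronwall
import Literature.Analysis.ODE.EvolutionMap
import HarnessLib

/-!
# Path-driven ODEs: Grönwall bound for the equation of variation; existence and uniqueness

Topic `Literature/Analysis/ODE` (namespace `Literature.Analysis.ODE`). Sequel to
`PathDrivenSmoothDependence.lean` (the path-driven integral equation
`v(τ) = x + ∫₀^τ G(c(s), v(s)) ds` on `I = [0, 1]`, `c ∈ C(I, P)` a merely continuous parameter
path, `G : P × E → E` of class `C^n`; smooth dependence of the solution family `Φ x` on `x` and
the equation of variation `w(τ) = δ + ∫₀^τ DG(c, Φ x₀) (0, w)`, `w = DΦ(x₀) δ`). Here: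

* `norm_fderiv_pathDriven_solution_family_apply_le` / `_eval_le` — **Grönwall bound**: if
  `‖DG(c(s), Φ x₀ (s)) (0, ·)‖ ≤ A` along the solution then `‖DΦ(x₀) δ (τ)‖ ≤ ‖δ‖ e^{A τ}` and
  `‖D(x ↦ Φ x τ)(x₀)‖ ≤ e^{A τ}` (Hartman, Ch. IV Lemma 4.1 applied to the equation of variation
  (V.3.3); the tree's `gronwall_integral_le`).
* `hasDerivWithinAt_pathDriven_solution` (`_Ici_`) / `pathDriven_solution_of_hasDerivWithinAt` —
  passage between the integral form (PD_x) and the differential form `ᾱ' = G(c̄, ᾱ)` within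
  `[0, 1]` (resp. right derivatives on `[0, 1)` plus continuity, the shape of the tree's SDE
  conjugation identities) — fundamental theorem of calculus, both directions.
* `exists_pathDriven_solution_family` — **existence and uniqueness** of the solution family when
  `v ↦ G(c(s), v)` is `K`-Lipschitz for every `s` (Cauchy–Lipschitz on `[0, 1]`: the tree's
  `exists_solution_Icc_of_lipschitzWith` and `eqOn_uIcc_of_lipschitzWith`, `EvolutionMap.lean`;
  Hartman Ch. II Thm. 1.1).

Everything is PROVED; no definitions, no named facts.

## References

* P. Hartman, *Ordinary Differential Equations*, Classics in Applied Mathematics 38, SIAM (2002),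
  Ch. II Thm. 1.1 (PDF pp. 18–19), Ch. IV Lemma 4.1, Ch. V Thm. 3.1 (PDF p. 95). [Hartman2002]
* H. Doss, Ann. Inst. H. Poincaré B 13 (1977) 99–125; H. J. Sussmann, Ann. Probab. 6 (1978) 19–41
  (ODEs driven by a continuous path). [folklore]
-/

noncomputable section

open Set Metric Filter Topology Function unitInterval MeasureTheory
open scoped ContDiff NNReal

namespace Literature.Analysis.ODE

universe u

section PathDriven

variable {P : Type u} [NormedAddCommGroup P] [NormedSpace ℝ P]
  {E : Type u} [NormedAddCommGroup E] [NormedSpace ℝ E]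

/-! ### Grönwall bound for the derivative -/

section Gronwall

variable [CompleteSpace P] [CompleteSpace E]

/-- **A priori bound for the equation of variation** (Grönwall): if the partial derivative of `G`
in `v` along the solution is bounded, `‖DG(c(s), Φ x₀ (s)) (0, v)‖ ≤ A ‖v‖` (`A ≥ 0`), then
`‖DΦ(x₀) δ (τ)‖ ≤ ‖δ‖ e^{A τ}` for `τ ∈ [0, 1]` (Hartman, Ch. IV, Lemma 4.1 applied to the equation
of variation (V.3.3)). [cite: Hartman2002, Ch. V Thm. 3.1 (PDF p. 95)] -/
theorem norm_fderiv_pathDriven_solution_family_apply_le {n : ℕ∞} {G : P × E → E}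
    (hG : ContDiff ℝ n G) (hn : 1 ≤ n) (c : C(I, P)) {Φ : E → C(I, E)}
    (hΦ : ∀ (x : E) (τ : I), Φ x τ = x + ∫ s in (0:ℝ)..(τ:ℝ),
      G (IccExtend zero_le_one c s, IccExtend zero_le_one (Φ x) s))
    (huniq : ∀ (x : E) (α : C(I, E)), (∀ τ : I, α τ = x + ∫ s in (0:ℝ)..(τ:ℝ),
      G (IccExtend zero_le_one c s, IccExtend zero_le_one α s)) → α = Φ x)
    (x₀ : E) {A : ℝ} (hA : 0 ≤ A)
    (hbound : ∀ (s : I) (v : E), ‖fderiv ℝ G (c s, Φ x₀ s) ((0 : P), v)‖ ≤ A * ‖v‖)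
    (δ : E) (τ : I) :
    ‖fderiv ℝ Φ x₀ δ τ‖ ≤ ‖δ‖ * Real.exp (A * τ) := by
  have hn0 : (n : WithTop ℕ∞) ≠ 0 := by
    have : n ≠ 0 := by rintro rfl; exact absurd hn (by simp)
    exact_mod_cast this
  set w : C(I, E) := fderiv ℝ Φ x₀ δ with hw
  -- the integrand of the equation of variation and its bound
  set F : ℝ → E := fun s => fderiv ℝ G (IccExtend zero_le_one c s, IccExtend zero_le_one (Φ x₀) s)
      ((0 : P), IccExtend zero_le_one w s) with hF
  have hFc : Continuous F := by
    have h1 : Continuous fun s : ℝ =>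
        fderiv ℝ G (IccExtend zero_le_one c s, IccExtend zero_le_one (Φ x₀) s) :=
      (hG.continuous_fderiv hn0).comp
        ((continuous_IccExtend_coe c).prodMk (continuous_IccExtend_coe (Φ x₀)))
    exact h1.clm_apply (continuous_const.prodMk (continuous_IccExtend_coe _))
  have hFle : ∀ s : ℝ, ‖F s‖ ≤ A * ‖IccExtend zero_le_one w s‖ := fun s => by
    simp only [hF, Set.IccExtend, comp_apply]
    exact hbound _ _
  -- the scalar function `g = ‖w̄‖` and the integral inequality
  set g : ℝ → ℝ := fun t => ‖IccExtend zero_le_one w t‖ with hg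
  have hgc : Continuous g := continuous_norm.comp (continuous_IccExtend_coe w)
  have hle : ∀ t ∈ Icc (0:ℝ) τ, g t ≤ ‖δ‖ + ∫ s in (0:ℝ)..t, A * g s := by
    intro t ht
    have ht1 : t ∈ Icc (0:ℝ) 1 := ⟨ht.1, ht.2.trans τ.2.2⟩
    have hwt : IccExtend zero_le_one w t = δ + ∫ s in (0:ℝ)..t, F s := by
      rw [IccExtend_of_mem _ _ ht1]
      exact fderiv_pathDriven_solution_family_apply hG hn c hΦ huniq x₀ δ ⟨t, ht1⟩
    calc g t = ‖δ + ∫ s in (0:ℝ)..t, F s‖ := by rw [hg]; simp only; rw [hwt]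
      _ ≤ ‖δ‖ + ‖∫ s in (0:ℝ)..t, F s‖ := norm_add_le _ _
      _ ≤ ‖δ‖ + ∫ s in (0:ℝ)..t, ‖F s‖ := by
          gcongr; exact intervalIntegral.norm_integral_le_integral_norm ht.1
      _ ≤ ‖δ‖ + ∫ s in (0:ℝ)..t, A * g s := by
          gcongr
          exact intervalIntegral.integral_mono_on ht.1
            ((continuous_norm.comp hFc).intervalIntegrable _ _)
            ((continuous_const.mul hgc).intervalIntegrable _ _) fun s _ => hFle s
  have h := gronwall_integral_le (T := (τ : ℝ)) τ.2.1 continuous_const hgc (fun _ => hA)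
    (monotoneOn_const) hle
  have hgτ : g τ = ‖w τ‖ := by
    simp only [hg]; rw [IccExtend_of_mem _ _ τ.2]
  rw [hgτ, intervalIntegral.integral_const, smul_eq_mul, sub_zero] at h
  simpa [mul_comm] using h

/-- Operator-norm form of the Grönwall bound: `‖D(x ↦ Φ x τ)(x₀)‖ ≤ e^{A τ}`.
[cite: Hartman2002, Ch. V Thm. 3.1 (PDF p. 95)] -/
theorem norm_fderiv_pathDriven_solution_family_eval_le {n : ℕ∞} {G : P × E → E}
    (hG : ContDiff ℝ n G) (hn : 1 ≤ n) (c : C(I, P)) {Φ : E → C(I, E)}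
    (hΦ : ∀ (x : E) (τ : I), Φ x τ = x + ∫ s in (0:ℝ)..(τ:ℝ),
      G (IccExtend zero_le_one c s, IccExtend zero_le_one (Φ x) s))
    (huniq : ∀ (x : E) (α : C(I, E)), (∀ τ : I, α τ = x + ∫ s in (0:ℝ)..(τ:ℝ),
      G (IccExtend zero_le_one c s, IccExtend zero_le_one α s)) → α = Φ x)
    (x₀ : E) {A : ℝ} (hA : 0 ≤ A)
    (hbound : ∀ (s : I) (v : E), ‖fderiv ℝ G (c s, Φ x₀ s) ((0 : P), v)‖ ≤ A * ‖v‖) (τ : I) :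
    ‖fderiv ℝ (fun x => Φ x τ) x₀‖ ≤ Real.exp (A * τ) := by
  have hn0 : (n : WithTop ℕ∞) ≠ 0 := by
    have : n ≠ 0 := by rintro rfl; exact absurd hn (by simp)
    exact_mod_cast this
  have hΦd : DifferentiableAt ℝ Φ x₀ :=
    (contDiffAt_pathDriven_solution_family hG hn c hΦ huniq x₀).differentiableAt hn0
  have hev : fderiv ℝ (fun x => Φ x τ) x₀ = (ContinuousMap.evalCLM ℝ τ (M := E)).comp (fderiv ℝ Φ x₀) :=
    ((ContinuousMap.evalCLM ℝ τ (M := E)).hasFDerivAt.comp x₀ hΦd.hasFDerivAt).fderiv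
  rw [hev]
  refine ContinuousLinearMap.opNorm_le_bound _ (Real.exp_pos _).le fun δ => ?_
  rw [mul_comm]
  exact norm_fderiv_pathDriven_solution_family_apply_le hG hn c hΦ huniq x₀ hA hbound δ τ

end Gronwall

/-! ### Differential form, existence and uniqueness (Cauchy–Lipschitz on `[0, 1]`) -/

section Existence

omit [NormedSpace ℝ P] in
/-- From the differential to the integral form: if `f` is continuous on `[0, 1]` with right
derivative `φ(t)` at every `t ∈ [0, 1)`, `φ` continuous, then `f(t) = f(0) + ∫₀ᵗ φ` on `[0, 1]`.
[folklore] -/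
private theorem eq_add_integral_of_hasDerivWithinAt_Ici [CompleteSpace E] {f φ : ℝ → E}
    (hφ : Continuous φ) (hfc : ContinuousOn f (Icc 0 1))
    (hf : ∀ t ∈ Ico (0:ℝ) 1, HasDerivWithinAt f (φ t) (Ici t) t) {t : ℝ} (ht : t ∈ Icc (0:ℝ) 1) :
    f t = f 0 + ∫ s in (0:ℝ)..t, φ s := by
  have hderiv : ∀ s ∈ Ioo 0 t, HasDerivWithinAt f (φ s) (Ioi s) s := fun s hs =>
    (hf s ⟨hs.1.le, hs.2.trans_le ht.2⟩).mono Ioi_subset_Ici_self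
  have h := intervalIntegral.integral_eq_sub_of_hasDeriv_right_of_le ht.1
    (hfc.mono (Icc_subset_Icc_right ht.2)) hderiv (hφ.intervalIntegrable _ _)
  rw [h]; abel

omit [NormedSpace ℝ P] in
/-- From the integral to the differential form: if `f(t) = x + ∫₀ᵗ φ` on `[0, 1]` with `φ`
continuous, then `f' = φ` within `[0, 1]`. [folklore] -/
private theorem hasDerivWithinAt_Icc_of_eq_add_integral [CompleteSpace E] {f φ : ℝ → E}
    (hφ : Continuous φ) (x : E) (hf : ∀ t ∈ Icc (0:ℝ) 1, f t = x + ∫ s in (0:ℝ)..t, φ s) {t : ℝ}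
    (ht : t ∈ Icc (0:ℝ) 1) : HasDerivWithinAt f (φ t) (Icc 0 1) t := by
  have hF : HasDerivAt (fun t => x + ∫ s in (0:ℝ)..t, φ s) (φ t) t :=
    ((hφ.integral_hasStrictDerivAt 0 t).hasDerivAt).const_add x
  exact hF.hasDerivWithinAt.congr (fun s hs => hf s hs) (hf t ht)

omit [NormedSpace ℝ P] in
/-- **Differential form of (PD_x).** A continuous solution `α` of the path-driven integral equation
solves `ᾱ' = G(c̄, ᾱ)` within `[0, 1]` (bars: extension by constants): "(2.10) is equivalent to
the following integral equation `x(t) = x₀ + ∫_{t₀}^t f(s, x(s)) ds` (2.11)".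
[cite: Teschl2012, §2.2 eq. (2.11) (PDF p. 47)] -/
theorem hasDerivWithinAt_pathDriven_solution [CompleteSpace E] {G : P × E → E} (hG : Continuous G)
    (c : C(I, P)) {x : E} {α : C(I, E)}
    (hα : ∀ τ : I, α τ = x + ∫ s in (0:ℝ)..(τ:ℝ),
      G (IccExtend zero_le_one c s, IccExtend zero_le_one α s)) {t : ℝ} (ht : t ∈ Icc (0:ℝ) 1) :
    HasDerivWithinAt (IccExtend zero_le_one α)
      (G (IccExtend zero_le_one c t, IccExtend zero_le_one α t)) (Icc 0 1) t := by
  have hφ : Continuous fun s : ℝ => G (IccExtend zero_le_one c s, IccExtend zero_le_one α s) :=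
    hG.comp ((continuous_IccExtend_coe c).prodMk (continuous_IccExtend_coe α))
  refine hasDerivWithinAt_Icc_of_eq_add_integral hφ x (fun s hs => ?_) ht
  rw [IccExtend_of_mem _ _ hs]
  exact hα ⟨s, hs⟩

omit [NormedSpace ℝ P] in
/-- Right-derivative form: a continuous solution `α` of (PD_x) has right derivative `G(c̄(t), ᾱ(t))`
at every `t ∈ [0, 1)`. [cite: Teschl2012, §2.2 eq. (2.11) (PDF p. 47)] -/
theorem hasDerivWithinAt_Ici_pathDriven_solution [CompleteSpace E] {G : P × E → E}
    (hG : Continuous G) (c : C(I, P)) {x : E} {α : C(I, E)}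
    (hα : ∀ τ : I, α τ = x + ∫ s in (0:ℝ)..(τ:ℝ),
      G (IccExtend zero_le_one c s, IccExtend zero_le_one α s)) {t : ℝ} (ht : t ∈ Ico (0:ℝ) 1) :
    HasDerivWithinAt (IccExtend zero_le_one α)
      (G (IccExtend zero_le_one c t, IccExtend zero_le_one α t)) (Ici t) t :=
  (hasDerivWithinAt_pathDriven_solution hG c hα (Ico_subset_Icc_self ht)).mono_of_mem_nhdsWithin
    (mem_of_superset (Icc_mem_nhdsGE ht.2) (Icc_subset_Icc ht.1 le_rfl))

omit [NormedSpace ℝ P] in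
/-- **Integral form of a differential solution.** If `f : ℝ → E` is continuous on `[0, 1]`,
`f(0) = x`, and `f` has right derivative `G(c̄(t), f(t))` at every `t ∈ [0, 1)`, then its
restriction to `[0, 1]` is a continuous solution of (PD_x) ("(2.10) is equivalent to the integral
equation (2.11)"). [cite: Teschl2012, §2.2 eq. (2.11) (PDF p. 47)] -/
theorem pathDriven_solution_of_hasDerivWithinAt [CompleteSpace E] {G : P × E → E}
    (hG : Continuous G) (c : C(I, P)) {x : E} {f : ℝ → E} (hf0 : f 0 = x)
    (hfc : ContinuousOn f (Icc 0 1))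
    (hf : ∀ t ∈ Ico (0:ℝ) 1, HasDerivWithinAt f (G (IccExtend zero_le_one c t, f t)) (Ici t) t) :
    ∃ hcont : Continuous (fun τ : I => f τ),
      ∀ τ : I, (⟨fun τ : I => f τ, hcont⟩ : C(I, E)) τ = x + ∫ s in (0:ℝ)..(τ:ℝ),
        G (IccExtend zero_le_one c s,
          IccExtend zero_le_one (⟨fun τ : I => f τ, hcont⟩ : C(I, E)) s) := by
  have hcont : Continuous (fun τ : I => f τ) := hfc.comp_continuous continuous_subtype_val fun τ => τ.2
  refine ⟨hcont, fun τ => ?_⟩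
  set α : C(I, E) := ⟨fun τ : I => f τ, hcont⟩ with hα
  have hext : ∀ s ∈ Icc (0:ℝ) 1, IccExtend zero_le_one α s = f s := fun s hs => by
    rw [IccExtend_of_mem _ _ hs]; rfl
  have hφ : Continuous fun s : ℝ => G (IccExtend zero_le_one c s, IccExtend zero_le_one α s) :=
    hG.comp ((continuous_IccExtend_coe c).prodMk (continuous_IccExtend_coe α))
  have hf' : ∀ t ∈ Ico (0:ℝ) 1, HasDerivWithinAt f
      (G (IccExtend zero_le_one c t, IccExtend zero_le_one α t)) (Ici t) t := fun t ht => by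
    rw [hext t (Ico_subset_Icc_self ht)]; exact hf t ht
  have h := eq_add_integral_of_hasDerivWithinAt_Ici hφ hfc hf' τ.2
  rw [hf0] at h
  exact h

omit [NormedSpace ℝ P] in
/-- **Existence and uniqueness of the solution family** (Cauchy–Lipschitz on `[0, 1]`): if `G` is
continuous and `v ↦ G(c(s), v)` is `K`-Lipschitz for every `s ∈ [0, 1]`, then (PD_x) has exactly
one continuous solution `Φ x` for every `x`. [cite: Hartman2002, Ch. II Thm. 1.1 (PDF pp. 18–19)] -/
theorem exists_pathDriven_solution_family [CompleteSpace E] {G : P × E → E} (hG : Continuous G)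
    (c : C(I, P)) {K : ℝ≥0} (hK : ∀ s : I, LipschitzWith K fun v => G (c s, v)) :
    ∃ Φ : E → C(I, E),
      (∀ (x : E) (τ : I), Φ x τ = x + ∫ s in (0:ℝ)..(τ:ℝ),
        G (IccExtend zero_le_one c s, IccExtend zero_le_one (Φ x) s)) ∧
      (∀ (x : E) (α : C(I, E)), (∀ τ : I, α τ = x + ∫ s in (0:ℝ)..(τ:ℝ),
        G (IccExtend zero_le_one c s, IccExtend zero_le_one α s)) → α = Φ x) := by
  -- the time-dependent field `v(t, y) = G(c̄(t), y)`
  set v : ℝ → E → E := fun t y => G (IccExtend zero_le_one c t, y) with hv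
  have hlip : ∀ t ∈ Icc (0:ℝ) 1, LipschitzWith K (v t) := fun t _ => hK _
  have hcont : ∀ y, ContinuousOn (v · y) (Icc 0 1) := fun y =>
    (hG.comp ((continuous_IccExtend_coe c).prodMk continuous_const)).continuousOn
  -- differential solutions through every point
  have hex : ∀ x : E, ∃ γ : ℝ → E, γ 0 = x ∧
      ∀ s ∈ Icc (0:ℝ) 1, HasDerivWithinAt γ (v s (γ s)) (Icc 0 1) s :=
    fun x => exists_solution_Icc_of_lipschitzWith zero_le_one hlip hcont x
  choose γ hγ0 hγ using hex
  have hγc' : ∀ x, ContinuousOn (γ x) (Icc 0 1) := fun x s hs => (hγ x s hs).continuousWithinAt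
  have hγ' : ∀ x, ∀ t ∈ Ico (0:ℝ) 1, HasDerivWithinAt (γ x) (v t (γ x t)) (Ici t) t :=
    fun x t ht => (hγ x t (Ico_subset_Icc_self ht)).mono_of_mem_nhdsWithin
      (mem_of_superset (Icc_mem_nhdsGE ht.2) (Icc_subset_Icc ht.1 le_rfl))
  have hsol : ∀ x, ∃ hc : Continuous (fun τ : I => γ x τ),
      ∀ τ : I, (⟨fun τ : I => γ x τ, hc⟩ : C(I, E)) τ = x + ∫ s in (0:ℝ)..(τ:ℝ),
        G (IccExtend zero_le_one c s,
          IccExtend zero_le_one (⟨fun τ : I => γ x τ, hc⟩ : C(I, E)) s) :=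
    fun x => pathDriven_solution_of_hasDerivWithinAt hG c (hγ0 x) (hγc' x) (hγ' x)
  choose hγc hγsol using hsol
  refine ⟨fun x => ⟨fun τ : I => γ x τ, hγc x⟩, hγsol, fun x α hα => ?_⟩
  -- uniqueness: both `ᾱ` and `γ x` solve `u' = v(t, u)` within `[0, 1]` from `x`
  have hα' : ∀ t ∈ Icc (0:ℝ) 1, HasDerivWithinAt (IccExtend zero_le_one α)
      (v t (IccExtend zero_le_one α t)) (Icc 0 1) t := fun t ht =>
    hasDerivWithinAt_pathDriven_solution hG c hα ht
  have hα0 : IccExtend zero_le_one α 0 = x := by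
    rw [IccExtend_of_mem _ _ (left_mem_Icc.2 zero_le_one)]
    have := hα ⟨0, left_mem_Icc.2 zero_le_one⟩
    simpa using this
  have heq : EqOn (IccExtend zero_le_one α) (γ x) (uIcc 0 1) := by
    refine eqOn_uIcc_of_lipschitzWith (v := v) (K := K) ?_ ?_ ?_ (by rw [hα0, hγ0])
    · rw [uIcc_of_le zero_le_one]; exact hlip
    · rw [uIcc_of_le zero_le_one]; exact hα'
    · rw [uIcc_of_le zero_le_one]; exact hγ x
  ext τ
  have h := heq (show (τ : ℝ) ∈ uIcc 0 1 by rw [uIcc_of_le zero_le_one]; exact τ.2)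
  rw [IccExtend_of_mem _ _ τ.2] at h
  exact h

end Existence

end PathDriven

end Literature.Analysis.ODE
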